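import Summits.QuantumAdvantage.QuantumAdvantage.Theorems.LightDialC4

/-! # LightDialC5 — part C5 — the pairing count, orientation, ★★★ `¬ LightFail 2 5`

NODE «LightDial» (decomp-qadv lens-2 g26) — the PREDECESSOR WITNESS `predW_b(x) = E_b + 2·E_b·O_b + 2·x_{b+1} (mod 3)` (`E_b/O_b` = number
of ones at the positions of the same / the other parity as `b`, even ring): an explicit rotation-covariant QUADRATIC strategy that is perfect on
every odd-class input of Hamming weight `≤ 5` at every even length — so `¬ LightFail 2 3` and `¬ LightFail 2 5` are THEOREMS (parts C3, C5) and the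
law-bet piece `LightFail 2 w → NoPerfectTwo3` of the dial (Theorems.LightDialA/B) is to be read at `w ≥ 7` (numerically the threshold is exactly 7:
g26 `num/Q-STRUCTURE.md`, critic 69v66). Five files C1 → … → C5 (gate form ≤ 400 lines each); rung 0, nothing here bears on 27432 itself.

THIS FILE: §14 (second half): predecessors of majority ones inside the arc vector (`arcVec_prv_of_out/_in`), `arc_cases` (`e ∈ {0,2}`), ★ the pairing
count `card_predIn` (`3` resp. `2`), `rel_of_three_two`; §15 re-basing the offset (`toff_rebase`, `toff_lt_rebase_iff`, `cnt_rebase`: the two arcs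
partition the majority ones, so one orientation has an even arc), `rel_of_parCount_eq_two`, ★★ `pred32Law_holds`, `predWPerfect_five`, and
★★★ `not_lightFail_two_five : ¬ LightFail 2 5`, `not_mem_lightLosing_two_five` (every even `n ≥ 4`), `not_lightFail_two_of_le_five'`.
-/

set_option linter.dupNamespace false
set_option linter.unnecessarySeqFocus false
noncomputable section
open scoped Classical

namespace Summit.QuantumAdvantage.QuantumAdvantage.Theorems.LightDial
open Finset
open Literature.Computability.QuantumComplexity Literature.Computability.QuantumComplexity.RingHLF
open Literature.Computability.MetaComplexity Literature.Computability.MetaComplexity.Smolensky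
open Summit.QuantumAdvantage.AdviceFreeQNC0
open Summit.QuantumAdvantage.QuantumAdvantage.Theorems.RingPeriodFold (kvec kernel_pair_of_oddZeros kvec_ne_zero rel_iff_of_kernel_pair)

variable {n : ℕ}

namespace TwoMinority
variable {x : Fin n → Bool} {p : ℕ} {c c' : Fin n}

/-! ### the pairing count: predecessors of majority ones inside the arc vector -/

/-- outside the arc the predecessor of a majority position reads the full (even) arc count: it is IN the vector. -/
theorem arcVec_prv_of_out (h : TwoMinority x p c c') {a : Fin n} (ha : par a = p) (hout : ¬ toff c a < toff c c') :
    arcVec x p c c' (prv a) = true := by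
  have hp2 := h.hp2; have hpp := par_prv h.even a; have ha2 := par_lt_two a
  have hb : par (prv a) ≠ p := by unfold par at *; omega
  have htodd := h.toff_odd_of_par_eq ha; have hT2 := h.T_even
  simp only [arcVec, hb, if_false, decide_eq_true_eq]
  rw [toff_prv, if_neg (by omega), min_eq_right (by omega), h.harc]

/-- inside the arc it reads the RANK of the majority one (number of majority ones before it). -/
theorem arcVec_prv_of_in (h : TwoMinority x p c c') {a : Fin n} (ha : par a = p) (hin : toff c a < toff c c') :
    arcVec x p c c' (prv a) = decide (cnt x p c (toff c a) % 2 = 0) := by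
  have hp2 := h.hp2; have hpp := par_prv h.even a; have ha2 := par_lt_two a
  have hb : par (prv a) ≠ p := by unfold par at *; omega
  have htodd := h.toff_odd_of_par_eq ha
  simp only [arcVec, hb, if_false]
  rw [toff_prv, if_neg (by omega), min_eq_left (by omega)]
  congr 2
  have e1 : toff c a = (toff c a - 1) + 1 := by omega
  conv_rhs => rw [e1, cnt_succ]
  rw [card_at_eq_zero, Nat.add_zero]
  intro i hi ⟨_, hip⟩
  have m1 := toff_mod_two h.even c i; have m2 := toff_mod_two h.even c a
  unfold par at *; omega

/-- the positions where the answer meets the arc vector are the predecessors of the majority ones whose predecessor is in the vector. -/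
theorem filter_dot_eq_image (h : TwoMinority x p c c') (hk : (univ.filter fun i : Fin n => x i = true ∧ par i = p).card = 3) :
    (univ.filter fun b : Fin n => arcVec x p c c' b = true ∧ predAns x b = true) =
      (univ.filter fun a : Fin n => x a = true ∧ par a = p ∧ arcVec x p c c' (prv a) = true).image prv := by
  ext b; simp only [mem_filter, mem_univ, true_and, mem_image]
  have hpn := par_nxt h.even b; have hb2 := par_lt_two b; have hp2 := h.hp2
  constructor
  · rintro ⟨hV, hz⟩
    have hb : par b ≠ p := by
      intro hb; rw [h.predAns_of_par_eq hk hb] at hz; exact Bool.false_ne_true hz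
    rw [h.predAns_of_par_ne hk hb] at hz
    have hn' : par (nxt b) = p := by unfold par at *; omega
    exact ⟨nxt b, ⟨hz, hn', by rw [prv_nxt]; exact hV⟩, prv_nxt b⟩
  · rintro ⟨a, ⟨ha, hpa, hV⟩, rfl⟩
    have hpp := par_prv h.even a; have ha2 := par_lt_two a
    have hb : par (prv a) ≠ p := by unfold par at *; omega
    exact ⟨hV, by rw [h.predAns_of_par_ne hk hb, nxt_prv]; exact ha⟩

/-- the arc holds `0` or `2` of the three majority ones. -/
theorem arc_cases (h : TwoMinority x p c c') (hk : (univ.filter fun i : Fin n => x i = true ∧ par i = p).card = 3) :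
    cnt x p c (toff c c') = 0 ∨ cnt x p c (toff c c') = 2 := by
  have hle : cnt x p c (toff c c') ≤ 3 := by
    rw [← hk]; unfold cnt; apply Finset.card_le_card
    intro i; simp only [mem_filter, mem_univ, true_and]; rintro ⟨h1, h2, _⟩; exact ⟨h1, h2⟩
  have := h.harc; omega

/-- ★ THE PAIRING COUNT: `3` predecessors in the vector if the arc is empty, `2` if it holds two majority ones (exactly one of even rank). -/
theorem card_predIn (h : TwoMinority x p c c') (hk : (univ.filter fun i : Fin n => x i = true ∧ par i = p).card = 3) :
    (univ.filter fun a : Fin n => x a = true ∧ par a = p ∧ arcVec x p c c' (prv a) = true).card =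
      if cnt x p c (toff c c') = 0 then 3 else 2 := by
  set S := univ.filter fun i : Fin n => x i = true ∧ par i = p with hS
  rcases h.arc_cases hk with e0 | e2
  · -- empty arc: every majority one is outside, its predecessor is in the vector
    rw [if_pos e0, ← hk]; congr 1; ext a; simp only [hS, mem_filter, mem_univ, true_and]
    constructor
    · rintro ⟨ha, hpa, _⟩; exact ⟨ha, hpa⟩
    · rintro ⟨ha, hpa⟩
      refine ⟨ha, hpa, h.arcVec_prv_of_out hpa fun hin => ?_⟩
      unfold cnt at e0; rw [Finset.card_eq_zero, Finset.filter_eq_empty_iff] at e0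
      exact e0 (mem_univ a) ⟨ha, hpa, hin⟩
  · -- two arc majority ones `a1, a2`: the earlier has rank 0 (in), the later rank 1 (out); the third one is outside (in)
    rw [if_neg (by omega)]
    have e2' := e2; unfold cnt at e2'
    obtain ⟨a1, a2, hne, hA⟩ := Finset.card_eq_two.mp e2'
    have hmemA : ∀ i : Fin n, (x i = true ∧ par i = p ∧ toff c i < toff c c') ↔ (i = a1 ∨ i = a2) := by
      intro i; have := Finset.ext_iff.mp hA i; simpa [mem_filter] using this
    obtain ⟨ha1, hpa1, ht1⟩ := (hmemA a1).mpr (Or.inl rfl)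
    obtain ⟨ha2, hpa2, ht2⟩ := (hmemA a2).mpr (Or.inr rfl)
    -- ranks inside the arc
    have hrank : ∀ a : Fin n, toff c a < toff c c' → cnt x p c (toff c a) =
        (({a1, a2} : Finset (Fin n)).filter fun i => toff c i < toff c a).card := by
      intro a haT; unfold cnt; congr 1; ext i
      simp only [mem_filter, mem_univ, true_and, mem_insert, mem_singleton]
      constructor
      · rintro ⟨h1, h2, h3⟩; exact ⟨(hmemA i).mp ⟨h1, h2, by omega⟩, h3⟩
      · rintro ⟨h12, h3⟩; obtain ⟨h1, h2, _⟩ := (hmemA i).mpr h12; exact ⟨h1, h2, h3⟩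
    have ht : toff c a1 ≠ toff c a2 := fun e => hne (toff_injective c e)
    have hr1 : cnt x p c (toff c a1) = if toff c a2 < toff c a1 then 1 else 0 := by
      rw [hrank a1 ht1, Finset.filter_insert, if_neg (lt_irrefl _), Finset.filter_singleton]
      split_ifs <;> simp
    have hr2 : cnt x p c (toff c a2) = if toff c a1 < toff c a2 then 1 else 0 := by
      rw [hrank a2 ht2, Finset.filter_insert, Finset.filter_singleton, if_neg (lt_irrefl _)]
      split_ifs <;> simp
    -- split the target set into outside (= S minus the arc pair) and inside (even rank)
    have hsplit := Finset.card_filter_add_card_filter_not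
      (s := univ.filter fun a : Fin n => x a = true ∧ par a = p ∧ arcVec x p c c' (prv a) = true)
      (fun a : Fin n => toff c a < toff c c')
    have hin_set : (univ.filter fun a : Fin n => x a = true ∧ par a = p ∧ arcVec x p c c' (prv a) = true).filter
        (fun a : Fin n => toff c a < toff c c') = ({a1, a2} : Finset (Fin n)).filter fun a => cnt x p c (toff c a) % 2 = 0 := by
      ext a; simp only [mem_filter, mem_univ, true_and, mem_insert, mem_singleton]
      constructor
      · rintro ⟨⟨ha, hpa, hV⟩, haT⟩
        refine ⟨(hmemA a).mp ⟨ha, hpa, haT⟩, ?_⟩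
        simpa [h.arcVec_prv_of_in hpa haT] using hV
      · rintro ⟨h12, hev⟩
        obtain ⟨ha, hpa, haT⟩ := (hmemA a).mpr h12
        exact ⟨⟨ha, hpa, by simpa [h.arcVec_prv_of_in hpa haT] using hev⟩, haT⟩
    have hout_set : (univ.filter fun a : Fin n => x a = true ∧ par a = p ∧ arcVec x p c c' (prv a) = true).filter
        (fun a : Fin n => ¬ toff c a < toff c c') = S.filter fun a : Fin n => ¬ toff c a < toff c c' := by
      ext a; simp only [hS, mem_filter, mem_univ, true_and]
      constructor
      · rintro ⟨⟨ha, hpa, _⟩, haT⟩; exact ⟨⟨ha, hpa⟩, haT⟩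
      · rintro ⟨⟨ha, hpa⟩, haT⟩; exact ⟨⟨ha, hpa, h.arcVec_prv_of_out hpa haT⟩, haT⟩
    have hSsplit := Finset.card_filter_add_card_filter_not (s := S) (fun a : Fin n => toff c a < toff c c')
    have hSin : (S.filter fun a : Fin n => toff c a < toff c c').card = 2 := by
      rw [← e2]; unfold cnt; congr 1; ext i; simp only [hS, mem_filter, mem_univ, true_and]
      constructor
      · rintro ⟨⟨h1, h2⟩, h3⟩; exact ⟨h1, h2, h3⟩
      · rintro ⟨h1, h2, h3⟩; exact ⟨⟨h1, h2⟩, h3⟩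
    have hin_card : (({a1, a2} : Finset (Fin n)).filter fun a => cnt x p c (toff c a) % 2 = 0).card = 1 := by
      rw [Finset.filter_insert, Finset.filter_singleton, hr1, hr2]
      rcases lt_trichotomy (toff c a1) (toff c a2) with hlt | heq | hgt
      · have h21 : ¬ toff c a2 < toff c a1 := not_lt.mpr hlt.le
        simp [hlt, h21]
      · exact absurd heq ht
      · have h12 : ¬ toff c a1 < toff c a2 := not_lt.mpr hgt.le
        simp [hgt, h12]
    rw [hin_set, hout_set, hin_card] at hsplit
    rw [hSin, hk] at hSsplit
    omega

/-- ★ split `(3,2)` DONE (oriented two-minority configuration with three majority ones). -/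
theorem rel_of_three_two (h : TwoMinority x p c c') (hx : OddZeros x)
    (hk : (univ.filter fun i : Fin n => x i = true ∧ par i = p).card = 3) : Rel x (predAns x) := by
  have hK := kernel_pair_of_oddZeros h.three hx
  rw [rel_iff_of_kernel_pair x (kvec x) _ hK, h.kvec_eq_arcVec hx, h.signBit_arcVec]
  unfold dot2
  rw [h.filter_dot_eq_image hk, Finset.card_image_of_injective _ prv_injective, h.card_predIn hk]
  rcases h.arc_cases hk with e0 | e2
  · rw [e0]; simp
  · rw [e2]; simp

end TwoMinority

/-! ## §15 Orientation and assembly: `Pred32Law` holds, `¬ LightFail 2 5` -/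

/-- re-basing the offset from `c` to `c'`. -/
theorem toff_rebase (c c' a : Fin n) :
    toff c' a = if toff c c' ≤ toff c a then toff c a - toff c c' else toff c a + n - toff c c' := by
  unfold toff; have := a.isLt; have := c.isLt; have := c'.isLt
  split_ifs <;> omega

/-- the arc from `c'` back to `c` is the complement of the arc from `c` to `c'`. -/
theorem toff_lt_rebase_iff {c c' : Fin n} (hcc : c ≠ c') (a : Fin n) :
    toff c' a < toff c' c ↔ ¬ toff c a < toff c c' := by
  have hv : c.val ≠ c'.val := fun e => hcc (Fin.ext e)
  rw [toff_rebase c c' a, toff_rebase c c' c, toff_self]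
  unfold toff; have := a.isLt; have := c.isLt; have := c'.isLt
  split_ifs <;> omega

/-- so the two arcs partition the majority ones. -/
theorem cnt_rebase {x : Fin n → Bool} {p : ℕ} {c c' : Fin n} (hcc : c ≠ c') :
    cnt x p c' (toff c' c) + cnt x p c (toff c c') = (univ.filter fun i : Fin n => x i = true ∧ par i = p).card := by
  have hsplit := Finset.card_filter_add_card_filter_not (s := univ.filter fun i : Fin n => x i = true ∧ par i = p)
    (fun i : Fin n => toff c i < toff c c')
  rw [Finset.filter_filter, Finset.filter_filter] at hsplit
  have e1 : (univ.filter fun i : Fin n => (x i = true ∧ par i = p) ∧ toff c i < toff c c') =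
      univ.filter fun i : Fin n => x i = true ∧ par i = p ∧ toff c i < toff c c' := by
    congr 1; ext i; exact and_assoc
  have e2 : (univ.filter fun i : Fin n => (x i = true ∧ par i = p) ∧ ¬ toff c i < toff c c') =
      univ.filter fun i : Fin n => x i = true ∧ par i = p ∧ toff c' i < toff c' c := by
    congr 1; ext i; rw [toff_lt_rebase_iff hcc]; exact and_assoc
  rw [e1, e2] at hsplit
  unfold cnt; omega

/-- the two-minority splits, packaged: parity `q` carries exactly two ones `c ≠ c'`, the other parity three; one of the two orientations
has an even arc. -/
theorem rel_of_parCount_eq_two (hn : Even n) (h3 : 3 ≤ n) {x : Fin n → Bool} (hx : OddZeros x) {p q : ℕ} (hp : p < 2) (hq : q < 2)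
    (hpq : p ≠ q) (h2 : parCount x q = 2) (hk : parCount x p = 3) : Rel x (predAns x) := by
  unfold parCount at h2 hk
  obtain ⟨c, c', hcc, hC⟩ := Finset.card_eq_two.mp h2
  have hmemC : ∀ i : Fin n, (x i = true ∧ par i = q) ↔ (i = c ∨ i = c') := by
    intro i; have := Finset.ext_iff.mp hC i; simpa [mem_filter] using this
  obtain ⟨hc, hqc⟩ := (hmemC c).mpr (Or.inl rfl)
  obtain ⟨hc', hqc'⟩ := (hmemC c').mpr (Or.inr rfl)
  have hmin : ∀ j, x j = true → par j ≠ p → j = c ∨ j = c' := by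
    intro j hj hpj; have := par_lt_two j
    exact (hmemC j).mp ⟨hj, by omega⟩
  have hmin' : ∀ j, x j = true → par j ≠ p → j = c' ∨ j = c := fun j hj hpj => (hmin j hj hpj).symm
  by_cases he : cnt x p c (toff c c') % 2 = 0
  · exact (TwoMinority.mk hn h3 hc hc' hcc (by omega) (by omega) hp hmin he).rel_of_three_two hx hk
  · have hsum := cnt_rebase (x := x) (p := p) hcc
    rw [hk] at hsum
    have he' : cnt x p c' (toff c' c) % 2 = 0 := by omega
    exact (TwoMinority.mk hn h3 hc' hc hcc.symm (by omega) (by omega) hp hmin' he').rel_of_three_two hx hk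

/-- ★★ THE `(3,2)` LAW HOLDS at every even length `≥ 3`. -/
theorem pred32Law_holds (hn : Even n) (h3 : 3 ≤ n) : Pred32Law n := by
  intro x hx h32
  rcases h32 with ⟨h0, h1⟩ | ⟨h0, h1⟩
  · exact rel_of_parCount_eq_two hn h3 hx (p := 0) (q := 1) (by norm_num) (by norm_num) (by norm_num) h1 h0
  · exact rel_of_parCount_eq_two hn h3 hx (p := 1) (q := 0) (by norm_num) (by norm_num) (by norm_num) h0 h1

/-- ★★ the predecessor witness is perfect on light weight `≤ 5` at every even length `≥ 3`. -/
theorem predWPerfect_five (hn : Even n) (h3 : 3 ≤ n) : PredWPerfect n 5 :=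
  predWPerfect_five_of_law32 hn h3 (pred32Law_holds hn h3)

/-- ★★★ `¬ LightFail 2 5` (THEOREM): the degree-2 light dial does not start before weight 7 — at every even length `n ≥ 4` the explicit
quadratic strategy `predW` answers every odd-class input of Hamming weight `≤ 5` correctly.  Census cell K-LD1(n,5) = SAT for all
even `n`, formally; the law-bet piece `LightFail 2 w → NoPerfectTwo3` of NODE «LightDial» is to be read at `w ≥ 7`. -/
theorem not_lightFail_two_five : ¬ LightFail 2 5 :=
  not_lightFail_two_five_of_law32 fun n hn h10 => pred32Law_holds hn (by omega)

/-- every even length `≥ 4` lies outside `lightLosing 2 5`. -/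
theorem not_mem_lightLosing_two_five (hn : Even n) (h4 : 4 ≤ n) : n ∉ lightLosing 2 5 :=
  not_mem_lightLosing_of_predWPerfect (predWPerfect_five hn (by omega))

/-- and `¬ LightFail 2 w` for every `w ≤ 5`. -/
theorem not_lightFail_two_of_le_five' {w : ℕ} (hw : w ≤ 5) : ¬ LightFail 2 w :=
  fun hf => not_lightFail_two_five (lightFail_mono hw hf)

end Summit.QuantumAdvantage.QuantumAdvantage.Theorems.LightDial
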